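import Mathlib.Combinatorics.HalesJewett
import Mathlib.Data.Fin.Tuple.Sort
import Mathlib.Data.Finset.Max
import Mathlib.Data.Fintype.Pi
import Mathlib.Data.Fintype.Card
import Mathlib.Order.Fin.Basic
import Mathlib.Tactic.Push
import Literature.Combinatorics.HalesJewett.SubspaceToolkit
import Literature.Combinatorics.HalesJewett.GrahamRothschildLevel
import HarnessLib

/-!
# The Graham–Rothschild theorem for combinatorial lines, I: statement, ordered subspaces, prefixes

Topic `Literature/Combinatorics/HalesJewett`. R. L. Graham, B. L. Rothschild, *Ramsey's theorem
for `n`-parameter sets*, Trans. Amer. Math. Soc. 159 (1971), 257–292, in the form of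
H. J. Prömel, *Ramsey Theory for Discrete Structures*, Springer (2013), Cor. 5.2 (case `k = 1`:
colourings of `1`-parameter words, monochromatic `m`-parameter word) = Dodos–Kanellopoulos–Tyros
2014, Prop. 2 (with `2` colours): the `Prop` `GrahamRothschildLines`. Mathlib has the Hales–Jewett
theorem (colourings of points) and its multidimensional version; the statement for LINES is
proved here and in `DKTGrahamRothschildProof.lean` along Prömel's proof of Thm. 5.1 (`k = 1`) and
Thm. 4.7 (`HJ*`), in the following encoding (coordinates `Fin n`, so that "first occurrence"
makes sense), on top of the tree's `SubspaceToolkit.lean` (`Subspace.comp`, `Subspace.line`,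
`Subspace.pat`, `Subspace.mapLetters`, Hales–Jewett in every large dimension) and
`GrahamRothschildLevel.lean` (`GrahamRothschild.firstCoord`, the first coordinate carrying a
direction):

* topic level, shared with the density Hales–Jewett files: the pointwise/reindexing helpers
  `Subspace.line_idxFun_apply`, `Subspace.mapLetters_some_coord`, `Subspace.mapLetters_some_idxFun`,
  `Subspace.mapLetters_some_comp_apply`, `lineReindex`, `subspaceReindex`, and the statement
  `GrahamRothschildLines`;
* route namespace `DKTGR` (this proof's helpers): `prefixLen w` — the length of the wildcard-free
  prefix of a word `w ∈ (Option α)^n` (Prömel's `|In(g)|`); `IsOrdered F` — Prömel's parameter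
  words: every occurrence of a direction `e'` of `F` is preceded by an occurrence of each `e < e'`
  (`exists_isOrdered_reindex`: any subspace becomes ordered after renaming its directions by
  `GrahamRothschild.firstCoord`; `IsOrdered.comp`; `exists_ordered_mono_subspace`);
* **Stage A** (`DKTGR.stageA`, Prömel's claim in the proof of Thm. 5.1): for `j ≤ D` and all
  large `n`, every colouring of the lines of `α^n` admits an ordered `D`-dimensional `F` such that
  the colour of `F ∘ ℓ` depends only on the prefix of `ℓ` before its first wildcard whenever that
  wildcard sits at a position `< j` (`DKTGR.PrefixClaim C F j` — the `j`-bounded variant, pulled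
  back along `F`, of `PrefixDetermined` of `GrahamRothschildPrefix.lean`); the step `j ↦ j+1`
  (`stageA_step`) is the multidimensional Hales–Jewett theorem over `Option α` with `κ^{α^j}`
  colours applied to the tails, the monochromatic subspace being re-read as Prömel's `f''`
  (`stepSubspace`: its extra letter `none` becomes the direction `j`).

The sibling files `GrahamRothschildPrefix.lean`/`GrahamRothschildLevel.lean` (another unit) run a
three-stage argument towards the same statement over general linearly ordered index types; this
file reuses their `firstCoord` but is otherwise an independent, `Fin`-indexed rendering of
Prömel's two-stage proof.

## References
* H. J. Prömel, *Ramsey Theory for Discrete Structures* (2013), Thm. 4.7, Thm. 5.1, Cor. 5.2. [cite: Promel2013]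
* P. Dodos, V. Kanellopoulos, K. Tyros, IMRN 2014, Prop. 2. [cite: DodosKanellopoulosTyros2014]
-/

open Combinatorics Finset

namespace Literature.Combinatorics.HalesJewett

/-! ### Composition and lines: pointwise forms (on top of `SubspaceToolkit`) -/

/-- Pointwise form of the variable word of `V.line l` (toolkit: `Subspace.line_idxFun`,
`Subspace.pat`). [folklore] -/
theorem Subspace.line_idxFun_apply {η α ι : Type*} (V : Subspace η α ι) (l : Line α η) (i : ι) :
    (Subspace.line V l).idxFun i = (V.idxFun i).elim some l.idxFun := rfl

/-! ### Lifting to the extended alphabet `Option α` (toolkit: `Subspace.mapLetters some`) -/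

/-- Coordinatewise formula for `V.mapLetters some` applied to a word over `Option α`: a constant
coordinate stays, a variable coordinate receives the entry of the word. [folklore] -/
theorem Subspace.mapLetters_some_coord {η α ι : Type*} (V : Subspace η α ι) (y : η → Option α) (i : ι) :
    (Subspace.mapLetters some V) y i = (V.idxFun i).elim some y := by
  simp only [Subspace.coe_apply, Subspace.mapLetters]
  cases V.idxFun i <;> simp

/-- `V.mapLetters some` applied to the variable word of `ℓ` is the variable word of `V.line ℓ`.
[folklore] -/
theorem Subspace.mapLetters_some_idxFun {η α ι : Type*} (V : Subspace η α ι) (l : Line α η) :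
    ⇑(Subspace.mapLetters some V) l.idxFun = (Subspace.line V l).idxFun := by
  funext i
  rw [Subspace.mapLetters_some_coord, Subspace.line_idxFun_apply]

/-- Lifting commutes with composition, pointwise on words. [folklore] -/
theorem Subspace.mapLetters_some_comp_apply {η η' α ι : Type*} (F : Subspace η α ι) (G : Subspace η' α η)
    (y : η' → Option α) :
    ⇑(Subspace.mapLetters some (Subspace.comp F G)) y =
      Subspace.mapLetters some F (Subspace.mapLetters some G y) := by
  rw [Subspace.mapLetters_comp, Subspace.comp_apply]


/-! ### Reindexing coordinates -/

/-- Reindexing the coordinates of a line. [folklore] -/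
def lineReindex {α ι ι' : Type*} (l : Line α ι) (e : ι ≃ ι') : Line α ι' where
  idxFun := l.idxFun ∘ e.symm
  proper := by
    obtain ⟨i, hi⟩ := l.proper
    exact ⟨e i, by simp [hi]⟩

/-- `(reindex ℓ e)(a) = ℓ(a) ∘ e⁻¹`. [folklore] -/
@[simp] theorem lineReindex_apply {α ι ι' : Type*} (l : Line α ι) (e : ι ≃ ι') (a : α) :
    ⇑(lineReindex l e) a = l a ∘ e.symm := by
  funext i; simp [lineReindex]

/-- Reindexing the coordinates of a subspace (Mathlib's `Subspace.reindex` with trivial alphabet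
and direction changes), with the apply lemma in the form used here. [folklore] -/
def subspaceReindex {η α ι ι' : Type*} (V : Subspace η α ι) (e : ι ≃ ι') : Subspace η α ι' :=
  V.reindex (Equiv.refl η) (Equiv.refl α) e

/-- `(reindex V e)(x) = V(x) ∘ e⁻¹`. [folklore] -/
@[simp] theorem subspaceReindex_apply {η α ι ι' : Type*} (V : Subspace η α ι) (e : ι ≃ ι') (x : η → α) :
    ⇑(subspaceReindex V e) x = V x ∘ e.symm := by
  funext i
  simp [subspaceReindex, Subspace.reindex_apply]


/-! ### The Graham–Rothschild theorem for lines (named fact) -/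

/-- **The Graham–Rothschild theorem, case of lines in `m`-spaces** (R. L. Graham,
B. L. Rothschild, Trans. AMS 159 (1971); H. J. Prömel, *Ramsey Theory for Discrete Structures*
(2013), Cor. 5.2 with `k = 1`; the form used by Dodos–Kanellopoulos–Tyros 2014, Prop. 2): for
every finite alphabet `α`, finite set of colours `κ` and `m ≥ 1` there is `N` such that for every
coordinate set `ι` with `|ι| ≥ N` and every colouring `C` of the combinatorial lines of `α^ι` there
is an `m`-dimensional combinatorial subspace `V` all of whose lines `V ∘ ℓ` (`ℓ` a line of
`α^m`) have the same colour. (Prömel's `m`-parameter words moreover have increasing first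
occurrences of the parameters; dropping that only weakens the conclusion.) Named fact, not in
Mathlib (which has the Hales–Jewett theorem = the case of points). Stated as a `Prop` so that the
density Hales–Jewett files can take it as a hypothesis `(h : GrahamRothschildLines)`; it is PROVED
in `DKTGrahamRothschildProof.lean` (`GrahamRothschildLines_holds`). (The parallel files
`GrahamRothschildPrefix/Level/Lines` of this directory and the port's `GrahamRothschild.lean`
head for the same statement; whichever is in the tree, the `Prop` here is equivalent to it.)
[cite: Promel2013, Corollary 5.2 (k = 1)] -/
def GrahamRothschildLines : Prop :=
  ∀ (α κ : Type) [Fintype α] [Fintype κ] (m : ℕ), 1 ≤ m → ∃ N : ℕ,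
    ∀ (ι : Type) [Fintype ι], N ≤ Fintype.card ι → ∀ C : Line α ι → κ,
      ∃ (V : Subspace (Fin m) α ι) (c : κ), ∀ l : Line α (Fin m), C (Subspace.line V l) = c


namespace DKTGR



/-! ### Prefix length (position of the first wildcard) -/

/-- The length of the wildcard-free prefix of a word `w ∈ (Option α)^n`: the position of the first
`none` (or `n`). For the word of a combinatorial line this is `min ℓ⁻¹(λ₀)` (Prömel: `|In(g)|`).
[cite: Promel2013, Theorem 5.1 (proof)] -/
def prefixLen {α : Type*} {n : ℕ} (w : Fin n → Option α) : ℕ :=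
  Nat.find (p := fun k => n ≤ k ∨ ∃ h : k < n, w ⟨k, h⟩ = none) ⟨n, Or.inl le_rfl⟩

/-- `prefixLen w ≤ n`. [folklore] -/
theorem prefixLen_le {α : Type*} {n : ℕ} (w : Fin n → Option α) : prefixLen w ≤ n :=
  Nat.find_min' _ (Or.inl le_rfl)

/-- `i < prefixLen w` iff the word has no wildcard up to position `i`. [folklore] -/
theorem lt_prefixLen_iff {α : Type*} {n : ℕ} (w : Fin n → Option α) (i : Fin n) :
    (i : ℕ) < prefixLen w ↔ ∀ j : Fin n, j ≤ i → w j ≠ none := by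
  unfold prefixLen
  rw [Nat.lt_find_iff]
  constructor
  · intro h j hji hj
    exact h j hji (Or.inr ⟨j.isLt, by simpa using hj⟩)
  · intro h k hk hor
    rcases hor with hnk | ⟨hkn, hk'⟩
    · exact absurd (lt_of_le_of_lt hk i.isLt) (not_lt.2 hnk)
    · exact h ⟨k, hkn⟩ hk hk'

/-- The letter at the prefix length is a wildcard (if the prefix is proper). [folklore] -/
theorem eq_none_prefixLen {α : Type*} {n : ℕ} (w : Fin n → Option α) (h : prefixLen w < n) :
    w ⟨prefixLen w, h⟩ = none := by
  have := Nat.find_spec (p := fun k => n ≤ k ∨ ∃ h : k < n, w ⟨k, h⟩ = none) ⟨n, Or.inl le_rfl⟩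
  rcases this with hle | ⟨h', hw⟩
  · exact absurd h (not_lt.2 hle)
  · exact hw

/-- Letters before the prefix length are not wildcards. [folklore] -/
theorem ne_none_of_lt_prefixLen {α : Type*} {n : ℕ} (w : Fin n → Option α) {i : Fin n}
    (h : (i : ℕ) < prefixLen w) : w i ≠ none :=
  (lt_prefixLen_iff w i).1 h i le_rfl

/-- A word with a wildcard has a proper prefix. [folklore] -/
theorem prefixLen_lt_of_exists {α : Type*} {n : ℕ} (w : Fin n → Option α) (h : ∃ i, w i = none) :
    prefixLen w < n := by
  obtain ⟨i, hi⟩ := h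
  by_contra hcon
  have : (i : ℕ) < prefixLen w := lt_of_lt_of_le i.isLt (not_lt.1 hcon)
  exact ne_none_of_lt_prefixLen w this hi

/-- A word is wildcard-free iff its prefix length is its length. [folklore] -/
theorem prefixLen_eq_length_iff {α : Type*} {n : ℕ} (w : Fin n → Option α) :
    prefixLen w = n ↔ ∀ i, w i ≠ none := by
  constructor
  · intro h i
    exact ne_none_of_lt_prefixLen w (by rw [h]; exact i.isLt)
  · intro h
    by_contra hne
    have hlt : prefixLen w < n := lt_of_le_of_ne (prefixLen_le w) hne
    exact h _ (eq_none_prefixLen w hlt)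

/-- `prefixLen w ≤ i` iff some wildcard occurs at a position `≤ i`. [folklore] -/
theorem prefixLen_le_iff {α : Type*} {n : ℕ} (w : Fin n → Option α) (i : Fin n) :
    prefixLen w ≤ i ↔ ∃ j : Fin n, j ≤ i ∧ w j = none := by
  rw [← not_lt, lt_prefixLen_iff]
  push Not
  rfl

/-- Two words with the same wildcard-free prefix of the same length have the same prefix length:
characterisation of `prefixLen w = p`. [folklore] -/
theorem prefixLen_eq_iff {α : Type*} {n : ℕ} (w : Fin n → Option α) (p : Fin n) :
    prefixLen w = p ↔ w p = none ∧ ∀ j : Fin n, j < p → w j ≠ none := by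
  constructor
  · intro h
    refine ⟨?_, fun j hj => ne_none_of_lt_prefixLen w (by rw [h]; exact hj)⟩
    have hlt : prefixLen w < n := by rw [h]; exact p.isLt
    have := eq_none_prefixLen w hlt
    convert this using 2
    exact Fin.ext h.symm
  · rintro ⟨hp, hlt⟩
    apply le_antisymm
    · exact (prefixLen_le_iff w p).2 ⟨p, le_rfl, hp⟩
    · by_contra hcon
      push Not at hcon
      have h1 : prefixLen w < n := lt_trans hcon p.isLt
      exact hlt ⟨prefixLen w, h1⟩ hcon (eq_none_prefixLen w h1)

/-! ### Ordered subspaces -/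

/-- A subspace of `α^n` with directions `Fin D` is *ordered* if every occurrence of a direction
`e'` is preceded by an occurrence of each smaller direction `e < e'` (equivalently: the first
occurrences of the directions increase — Prömel's parameter words). [cite: Promel2013, Chapter 3 (parameter words)] -/
def IsOrdered {α : Type*} {D n : ℕ} (F : Subspace (Fin D) α (Fin n)) : Prop :=
  ∀ e e' : Fin D, e < e' → ∀ i' : Fin n, F.idxFun i' = Sum.inr e' → ∃ i : Fin n, i < i' ∧ F.idxFun i = Sum.inr e

/-- Composites of ordered subspaces are ordered. [folklore] -/
theorem IsOrdered.comp {α : Type*} {D D' n : ℕ} {F : Subspace (Fin D') α (Fin n)} {G : Subspace (Fin D) α (Fin D')}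
    (hF : IsOrdered F) (hG : IsOrdered G) : IsOrdered (Subspace.comp F G) := by
  intro e e' hee' i' hi'
  simp only [Subspace.comp] at hi' ⊢
  cases hF' : F.idxFun i' with
  | inl a => rw [hF'] at hi'; simp at hi'
  | inr t' =>
    rw [hF'] at hi'
    simp only [Sum.elim_inr] at hi'
    obtain ⟨t, htt', ht⟩ := hG e e' hee' t' hi'
    obtain ⟨i, hii', hi⟩ := hF t t' htt' i' hF'
    exact ⟨i, hii', by rw [hi]; simpa using ht⟩

/-- In an ordered subspace the first occurrences (`GrahamRothschild.firstCoord`) increase. [folklore] -/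
theorem IsOrdered.firstCoord_lt {α : Type*} [DecidableEq α] {D n : ℕ} {F : Subspace (Fin D) α (Fin n)} (hF : IsOrdered F)
    {e e' : Fin D} (h : e < e') : GrahamRothschild.firstCoord F e < GrahamRothschild.firstCoord F e' := by
  obtain ⟨i, hi, hie⟩ := hF e e' h _ (GrahamRothschild.idxFun_firstCoord F e')
  exact lt_of_le_of_lt (GrahamRothschild.firstCoord_le F hie) hi

/-- In an ordered subspace, positions before the first occurrence of `e` carry only smaller
directions. [folklore] -/
theorem IsOrdered.lt_of_lt_firstCoord {α : Type*} [DecidableEq α] {D n : ℕ} {F : Subspace (Fin D) α (Fin n)} (hF : IsOrdered F)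
    {e t : Fin D} {i : Fin n} (hi : F.idxFun i = Sum.inr t) (hlt : i < GrahamRothschild.firstCoord F e) : t < e := by
  by_contra hcon
  push Not at hcon
  rcases hcon.lt_or_eq with h | h
  · obtain ⟨i₀, hi₀, hie⟩ := hF e t h i hi
    exact absurd (lt_trans hi₀ hlt) (not_lt.2 (GrahamRothschild.firstCoord_le F hie))
  · subst h
    exact absurd hlt (not_lt.2 (GrahamRothschild.firstCoord_le F hi))

/-- The word of a direction-renamed subspace. [folklore] -/
theorem Subspace.reindex_perm_idxFun {α : Type*} {D n : ℕ} (S : Subspace (Fin D) α (Fin n)) (σ : Equiv.Perm (Fin D))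
    (i : Fin n) : (S.reindex σ (Equiv.refl α) (Equiv.refl (Fin n))).idxFun i = (S.idxFun i).map id σ := rfl

/-- Every subspace becomes ordered after renaming its directions (sorting by first occurrence).
[folklore] -/
theorem exists_isOrdered_reindex {α : Type*} [DecidableEq α] {D n : ℕ} (S : Subspace (Fin D) α (Fin n)) :
    ∃ σ : Equiv.Perm (Fin D), IsOrdered (S.reindex σ (Equiv.refl α) (Equiv.refl (Fin n))) := by
  set pos : Fin D → Fin n := GrahamRothschild.firstCoord S with hpos
  set τ : Equiv.Perm (Fin D) := Tuple.sort pos with hτ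
  have hmono : StrictMono (pos ∘ τ) :=
    (Tuple.monotone_sort pos).strictMono_of_injective ((GrahamRothschild.firstCoord_injective S).comp τ.injective)
  refine ⟨τ.symm, ?_⟩
  intro e e' hee' i' hi'
  rw [Subspace.reindex_perm_idxFun] at hi'
  cases hS : S.idxFun i' with
  | inl a => rw [hS] at hi'; simp at hi'
  | inr t' =>
    rw [hS] at hi'
    simp only [Sum.map_inr, Sum.inr.injEq] at hi'
    have ht' : t' = τ e' := by rw [← hi']; simp
    have hlt : pos (τ e) < pos (τ e') := hmono hee'
    refine ⟨pos (τ e), ?_, ?_⟩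
    · calc pos (τ e) < pos (τ e') := hlt
        _ ≤ i' := by rw [← ht']; exact GrahamRothschild.firstCoord_le S hS
    · rw [Subspace.reindex_perm_idxFun, GrahamRothschild.idxFun_firstCoord S (τ e)]
      simp

/-! ### The (multidimensional) Hales–Jewett theorem for all large `n`, with ordered subspaces -/

/-- The multidimensional Hales–Jewett theorem in every large dimension `Fin n` (toolkit:
`exists_mono_subspace_of_card_le`), with the monochromatic subspace ORDERED (rename its
directions by `exists_isOrdered_reindex`). [folklore] -/
theorem exists_ordered_mono_subspace (α κ : Type) [Fintype α] [Nonempty α] [DecidableEq α] [Finite κ] (d : ℕ) :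
    ∃ N : ℕ, ∀ n : ℕ, N ≤ n → ∀ C : (Fin n → α) → κ,
      ∃ S : Subspace (Fin d) α (Fin n), IsOrdered S ∧ ∃ c : κ, ∀ x, C (S x) = c := by
  obtain ⟨N, hN⟩ := exists_mono_subspace_of_card_le α κ (Fin d)
  refine ⟨N, fun n hn C => ?_⟩
  obtain ⟨S₁, c, hc⟩ := hN (Fin n) (by simpa using hn) C
  obtain ⟨σ, hσ⟩ := exists_isOrdered_reindex S₁
  refine ⟨S₁.reindex σ (Equiv.refl α) (Equiv.refl (Fin n)), hσ, c, fun x => ?_⟩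
  have : ⇑(S₁.reindex σ (Equiv.refl α) (Equiv.refl (Fin n))) x = S₁ (x ∘ σ) := by
    funext i; simp [Subspace.reindex_apply]
  rw [this]
  exact hc _




/-! ### The prefix claim -/

/-- Prömel's inductive claim in the proof of Thm. 5.1 (`k = 1`): for lines `g, h` of the subspace
`F` whose first wildcard occurs at the same position `< j` and whose prefixes before it agree
(`In(g) = In(h)`, `|In(g)| < j`), the colours of `F ∘ g` and `F ∘ h` agree.
[cite: Promel2013, Theorem 5.1 (proof)] -/
def PrefixClaim {α κ : Type*} {D n : ℕ} (C : Line α (Fin n) → κ) (F : Subspace (Fin D) α (Fin n)) (j : ℕ) : Prop :=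
  ∀ l l' : Line α (Fin D), prefixLen l.idxFun = prefixLen l'.idxFun → prefixLen l.idxFun < j →
    (∀ i : Fin D, (i : ℕ) < prefixLen l.idxFun → l.idxFun i = l'.idxFun i) →
    C (Subspace.line F l) = C (Subspace.line F l')

/-- The ordered `D`-dimensional subspace of `α^n` on the first `D` coordinates (`D ≤ n`), the other
coordinates frozen to `a₀`. [folklore] -/
def initialSubspace {α : Type*} (D n : ℕ) (h : D ≤ n) (a₀ : α) : Subspace (Fin D) α (Fin n) where
  idxFun i := if hi : (i : ℕ) < D then Sum.inr ⟨i, hi⟩ else Sum.inl a₀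
  proper e := ⟨⟨e, lt_of_lt_of_le e.isLt h⟩, by simp⟩

/-- `firstCoords` is ordered. [folklore] -/
theorem isOrdered_initialSubspace {α : Type*} (D n : ℕ) (h : D ≤ n) (a₀ : α) :
    IsOrdered (initialSubspace D n h a₀) := by
  intro e e' hee' i' hi'
  simp only [initialSubspace] at hi' ⊢
  split_ifs at hi' with h1
  · simp only [Sum.inr.injEq] at hi'
    have hi'e : (i' : ℕ) = e' := by rw [← hi']
    refine ⟨⟨e, lt_of_lt_of_le e.isLt h⟩, ?_, ?_⟩
    · rw [Fin.lt_def, hi'e]; exact hee'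
    · simp

/-! ### The step subspace -/

/-- The word `(a, ∗, u)` of length `j + 1 + N₀`: letters `a` on the first `j` positions, a wildcard
at position `j`, then the tail `u` (a word over `Option α`, `none` = wildcard). These are the line
words whose first wildcard is at position `j`. [cite: Promel2013, Theorem 5.1 (proof, `Δ^j`)] -/
def tailWord {α : Type*} {j N₀ : ℕ} (a : Fin j → α) (u : Fin N₀ → Option α) : Fin (j + 1 + N₀) → Option α :=
  fun i => if h : (i : ℕ) < j then some (a ⟨i, h⟩) else if h' : (i : ℕ) = j then none
    else u ⟨(i : ℕ) - (j + 1), by omega⟩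

/-- `(a, ∗, u)` as a combinatorial line of `α^{j+1+N₀}`. [cite: Promel2013, Theorem 5.1 (proof)] -/
def tailLine {α : Type*} {j N₀ : ℕ} (a : Fin j → α) (u : Fin N₀ → Option α) : Line α (Fin (j + 1 + N₀)) where
  idxFun := tailWord a u
  proper := ⟨⟨j, by omega⟩, by simp [tailWord]⟩

/-- Prömel's `f''` for the step `j ↦ j+1` of Thm. 5.1 (`k = 1`): from a subspace `S` of
`(Option α)^{N₀}` of dimension `d'`, the subspace of `α^{j+1+N₀}` of dimension `D`
(`j + 1 + d' ≤ D`... here `D = j + 1 + d'` is passed with a proof) whose first `j+1` directions sit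
singly on the first `j+1` positions, the extra letter `none` of `S` becoming the direction `j` and
the directions of `S` shifted by `j+1`. [cite: Promel2013, Theorem 5.1 (proof, `f''`)] -/
def stepSubspace {α : Type*} {j N₀ d' D : ℕ} (hD : D = j + 1 + d') (S : Subspace (Fin d') (Option α) (Fin N₀)) :
    Subspace (Fin D) α (Fin (j + 1 + N₀)) where
  idxFun i :=
    if h : (i : ℕ) < j + 1 then Sum.inr ⟨i, by omega⟩
    else match S.idxFun ⟨(i : ℕ) - (j + 1), by omega⟩ with
      | Sum.inl (some a) => Sum.inl a
      | Sum.inl none => Sum.inr ⟨j, by omega⟩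
      | Sum.inr e => Sum.inr ⟨j + 1 + e, by omega⟩
  proper e := by
    by_cases he : (e : ℕ) < j + 1
    · exact ⟨⟨e, by omega⟩, by simp [he]⟩
    · obtain ⟨t, ht⟩ := S.proper ⟨(e : ℕ) - (j + 1), by omega⟩
      refine ⟨⟨j + 1 + t, by omega⟩, ?_⟩
      have h1 : ¬ (j + 1 + (t : ℕ) < j + 1) := by omega
      simp only [h1, dif_neg, not_false_eq_true]
      have h2 : (⟨j + 1 + (t : ℕ) - (j + 1), by omega⟩ : Fin N₀) = t := Fin.ext (by simp)
      rw [h2, ht]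
      simp only [Sum.inr.injEq, Fin.ext_iff]
      omega

/-- `stepSubspace` is ordered when `S` is. [folklore] -/
theorem isOrdered_stepSubspace {α : Type*} [DecidableEq α] {j N₀ d' D : ℕ} (hD : D = j + 1 + d')
    {S : Subspace (Fin d') (Option α) (Fin N₀)} (hS : IsOrdered S) : IsOrdered (stepSubspace hD S) := by
  intro e e' hee' i' hi'
  simp only [stepSubspace] at hi' ⊢
  by_cases h1 : (i' : ℕ) < j + 1
  · -- `i'` in the first block: then `e' = i'` and `e < e' < j+1` occurs at position `e`
    rw [dif_pos h1] at hi'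
    simp only [Sum.inr.injEq] at hi'
    have he' : (e' : ℕ) = i' := by rw [← hi']
    refine ⟨⟨e, by omega⟩, ?_, ?_⟩
    · rw [Fin.lt_def]; simp; omega
    · have : (e : ℕ) < j + 1 := by omega
      rw [dif_pos this]
  · rw [dif_neg h1] at hi'
    -- `i'` in the tail: `e'` is `j` (extra letter) or `j+1+e₀` (a direction of `S`)
    by_cases he : (e : ℕ) < j + 1
    · -- a small direction occurs in the first block, before `i'`
      refine ⟨⟨e, by omega⟩, ?_, ?_⟩
      · rw [Fin.lt_def]; simp; omega
      · rw [dif_pos he]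
    · -- both `e` and `e'` are shifted directions of `S`; use that `S` is ordered
      push Not at he
      split at hi'
      · simp at hi'
      · simp only [Sum.inr.injEq] at hi'
        have : (e' : ℕ) = j := by rw [← hi']
        omega
      · rename_i e₀ hSe
        simp only [Sum.inr.injEq] at hi'
        have he'v : (e' : ℕ) = j + 1 + e₀ := by rw [← hi']
        set e₁ : Fin d' := ⟨(e : ℕ) - (j + 1), by omega⟩ with he₁
        have hlt : e₁ < e₀ := by rw [Fin.lt_def]; simp [he₁]; omega
        obtain ⟨t, htlt, ht⟩ := hS e₁ e₀ hlt _ hSe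
        refine ⟨⟨j + 1 + t, by omega⟩, ?_, ?_⟩
        · rw [Fin.lt_def]; simp; rw [Fin.lt_def] at htlt; simp at htlt; omega
        · have h2 : ¬ (j + 1 + (t : ℕ) < j + 1) := by omega
          rw [dif_neg h2]
          have h3 : (⟨j + 1 + (t : ℕ) - (j + 1), by omega⟩ : Fin N₀) = t := Fin.ext (by simp)
          rw [h3, ht]
          simp only [Sum.inr.injEq, Fin.ext_iff, Fin.val_mk, he₁]
          omega


/-- The word of a line of `stepSubspace S`. [cite: Promel2013, Theorem 5.1 (proof)] -/
theorem compLine_stepSubspace_idxFun {α : Type*} {j N₀ d' D : ℕ} (hD : D = j + 1 + d')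
    (S : Subspace (Fin d') (Option α) (Fin N₀)) (l : Line α (Fin D)) (i : Fin (j + 1 + N₀)) :
    (Subspace.line (stepSubspace hD S) l).idxFun i =
      if h : (i : ℕ) < j + 1 then l.idxFun ⟨i, by omega⟩
      else match S.idxFun ⟨(i : ℕ) - (j + 1), by omega⟩ with
        | Sum.inl (some a) => some a
        | Sum.inl none => l.idxFun ⟨j, by omega⟩
        | Sum.inr e => l.idxFun ⟨j + 1 + e, by omega⟩ := by
  rw [Subspace.line_idxFun_apply]
  simp only [stepSubspace]
  split_ifs with h
  · rfl
  · split <;> rename_i hS <;> simp [hS]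

/-- Lines of `stepSubspace S` whose first wildcard is at a position `p < j+1` keep their prefix and
prefix length. [cite: Promel2013, Theorem 5.1 (proof)] -/
theorem prefixLen_compLine_stepSubspace {α : Type*} {j N₀ d' D : ℕ} (hD : D = j + 1 + d')
    (S : Subspace (Fin d') (Option α) (Fin N₀)) (l : Line α (Fin D)) (hp : prefixLen l.idxFun < j + 1) :
    prefixLen (Subspace.line (stepSubspace hD S) l).idxFun = prefixLen l.idxFun := by
  have hpD : prefixLen l.idxFun < D := by omega
  rw [prefixLen_eq_iff _ ⟨prefixLen l.idxFun, by omega⟩]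
  constructor
  · rw [compLine_stepSubspace_idxFun, dif_pos (by exact hp)]
    exact eq_none_prefixLen l.idxFun hpD
  · intro i hi
    rw [Fin.lt_def] at hi
    simp only at hi
    rw [compLine_stepSubspace_idxFun, dif_pos (by omega)]
    exact ne_none_of_lt_prefixLen l.idxFun (by simpa using hi)

/-- Lines of `stepSubspace S` whose first wildcard is at position `j` are the lines `(a, ∗, S u)`.
[cite: Promel2013, Theorem 5.1 (proof)] -/
theorem compLine_stepSubspace_eq_tailLine {α : Type*} {j N₀ d' D : ℕ} (hD : D = j + 1 + d')
    (S : Subspace (Fin d') (Option α) (Fin N₀)) (l : Line α (Fin D)) (hp : prefixLen l.idxFun = j) :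
    Subspace.line (stepSubspace hD S) l =
      tailLine (fun i : Fin j => (l.idxFun ⟨i, by omega⟩).get
          (Option.isSome_iff_ne_none.2 (ne_none_of_lt_prefixLen l.idxFun (by simp [hp]))))
        (S fun e : Fin d' => l.idxFun ⟨j + 1 + e, by omega⟩) := by
  apply Line.ext
  funext i
  rw [compLine_stepSubspace_idxFun]
  simp only [tailLine, tailWord]
  by_cases h1 : (i : ℕ) < j
  · rw [dif_pos (by omega), dif_pos h1, Option.some_get]
  · rw [dif_neg h1]
    by_cases h2 : (i : ℕ) = j
    · rw [dif_pos (by omega), dif_pos h2]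
      have : (⟨(i : ℕ), by omega⟩ : Fin D) = ⟨j, by omega⟩ := Fin.ext h2
      rw [this]
      have hjD : j < D := by omega
      have := eq_none_prefixLen l.idxFun (by rw [hp]; exact hjD)
      convert this using 2; exact Fin.ext hp.symm
    · rw [dif_neg (by omega), dif_neg h2, Subspace.coe_apply]
      cases S.idxFun ⟨(i : ℕ) - (j + 1), by omega⟩ with
      | inl o =>
        cases o with
        | some a => rfl
        | none =>
          simp only [Sum.elim_inl, id_eq]
          have hjD : j < D := by omega
          have := eq_none_prefixLen l.idxFun (by rw [hp]; exact hjD)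
          convert this using 2; exact Fin.ext hp.symm
      | inr e => rfl

/-- **Stage A, inductive step** (Prömel Thm. 5.1, `k = 1`, the step `j ↦ j+1` of the claim): from
ordered subspaces with the prefix claim below `j` in every dimension, ordered subspaces with the
prefix claim below `j+1`, via the multidimensional Hales–Jewett theorem over `Option α` with
`κ^{α^j}` colours. [cite: Promel2013, Theorem 5.1 (proof)] -/
theorem stageA_step {α κ : Type} [Fintype α] [DecidableEq α] [Nonempty α] [Fintype κ] (j : ℕ)
    (ih : ∀ D : ℕ, j ≤ D → ∃ N : ℕ, ∀ n : ℕ, N ≤ n → ∀ C : Line α (Fin n) → κ,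
      ∃ F : Subspace (Fin D) α (Fin n), IsOrdered F ∧ PrefixClaim C F j) :
    ∀ D : ℕ, j + 1 ≤ D → ∃ N : ℕ, ∀ n : ℕ, N ≤ n → ∀ C : Line α (Fin n) → κ,
      ∃ F : Subspace (Fin D) α (Fin n), IsOrdered F ∧ PrefixClaim C F (j + 1) := by
  classical
  intro D hD
  have hD' : D = j + 1 + (D - (j + 1)) := by omega
  obtain ⟨N₀, hN₀⟩ := exists_ordered_mono_subspace (Option α) ((Fin j → α) → κ) (D - (j + 1))
  obtain ⟨N, hN⟩ := ih (j + 1 + N₀) (by omega)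
  refine ⟨N, fun n hn C => ?_⟩
  obtain ⟨Fj, hFjo, hFjc⟩ := hN n hn C
  set χ : (Fin N₀ → Option α) → ((Fin j → α) → κ) := fun u a => C (Subspace.line Fj (tailLine a u)) with hχ
  obtain ⟨S, hSo, c₀, hc₀⟩ := hN₀ N₀ le_rfl χ
  refine ⟨Subspace.comp Fj (stepSubspace hD' S), hFjo.comp (isOrdered_stepSubspace hD' hSo), ?_⟩
  intro l l' hpeq hpj hagree
  rw [Subspace.comp_line, Subspace.comp_line]
  rcases Nat.lt_succ_iff_lt_or_eq.1 hpj with hlt | heq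
  · -- first wildcard before position `j`: the claim for `F_j`
    refine hFjc _ _ ?_ ?_ ?_
    · rw [prefixLen_compLine_stepSubspace hD' S l hpj, prefixLen_compLine_stepSubspace hD' S l' (by omega), hpeq]
    · rw [prefixLen_compLine_stepSubspace hD' S l hpj]; exact hlt
    · intro i hi
      rw [prefixLen_compLine_stepSubspace hD' S l hpj] at hi
      have hi' : (i : ℕ) < j + 1 := by omega
      rw [compLine_stepSubspace_idxFun, compLine_stepSubspace_idxFun, dif_pos hi', dif_pos hi']
      exact hagree ⟨i, by omega⟩ hi
  · -- first wildcard at position `j`: the monochromatic `S`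
    have heq' : prefixLen l'.idxFun = j := by rw [← hpeq, heq]
    rw [compLine_stepSubspace_eq_tailLine hD' S l heq, compLine_stepSubspace_eq_tailLine hD' S l' heq']
    have ha : (fun i : Fin j => (l.idxFun ⟨i, by omega⟩).get
          (Option.isSome_iff_ne_none.2 (ne_none_of_lt_prefixLen l.idxFun (by simp [heq])))) =
        (fun i : Fin j => (l'.idxFun ⟨i, by omega⟩).get
          (Option.isSome_iff_ne_none.2 (ne_none_of_lt_prefixLen l'.idxFun (by simp [heq'])))) := by
      funext i
      have := hagree ⟨i, by omega⟩ (by rw [heq]; exact i.isLt)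
      simp only [this]
    rw [ha]
    have h1 := congrFun (hc₀ fun e => l.idxFun ⟨j + 1 + e, by omega⟩)
      (fun i : Fin j => (l'.idxFun ⟨i, by omega⟩).get
        (Option.isSome_iff_ne_none.2 (ne_none_of_lt_prefixLen l'.idxFun (by simp [heq']))))
    have h2 := congrFun (hc₀ fun e => l'.idxFun ⟨j + 1 + e, by omega⟩)
      (fun i : Fin j => (l'.idxFun ⟨i, by omega⟩).get
        (Option.isSome_iff_ne_none.2 (ne_none_of_lt_prefixLen l'.idxFun (by simp [heq']))))
    simp only [hχ] at h1 h2
    rw [h1, h2]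

/-- **Stage A** (the claim of Prömel Thm. 5.1, `k = 1`, for all `j`): for every `j ≤ D` and all
large `n`, every colouring of the lines of `α^n` admits an ordered `D`-dimensional subspace `F`
such that the colour of a line `F ∘ ℓ` whose first wildcard is at a position `< j` depends only on
the prefix of `ℓ` before it. [cite: Promel2013, Theorem 5.1 (proof)] -/
theorem stageA {α κ : Type} [Fintype α] [DecidableEq α] [Nonempty α] [Fintype κ] :
    ∀ j D : ℕ, j ≤ D → ∃ N : ℕ, ∀ n : ℕ, N ≤ n → ∀ C : Line α (Fin n) → κ,
      ∃ F : Subspace (Fin D) α (Fin n), IsOrdered F ∧ PrefixClaim C F j := by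
  intro j
  induction j with
  | zero =>
    intro D _
    obtain ⟨a₀⟩ := (inferInstance : Nonempty α)
    refine ⟨D, fun n hn C => ⟨initialSubspace D n hn a₀, isOrdered_initialSubspace D n hn a₀, ?_⟩⟩
    intro l l' _ hlt _
    exact absurd hlt (Nat.not_lt_zero _)
  | succ j ih => exact stageA_step j ih


end DKTGR

end Literature.Combinatorics.HalesJewett
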